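import Literature.Computability.Complexity.FoldBricks
import Literature.Computability.Complexity.HashBricks
import Literature.Computability.Complexity.FPStringBricks
import Literature.Computability.Complexity.StackBricksArith
import Literature.Computability.Complexity.PlumbingBricks
import Literature.Computability.Complexity.StackNumeric
import Literature.Computability.MetaComplexity.NWGenerator
import HarnessLib

/-!
# The learner's NW design in `FP`: block positions and seed restrictions as string functions

Machine-layer instalment (M1) of the decomposition of the named fact
`Literature.Computability.Learning.cikk_natural_implies_learning` (CIKK 2016, Thm. 5.1). The
learner, the hypothesis evaluator and the circuit-size bound for the NW outputs all need the
map "block index `v ∈ {0,1}^ℓ`, block position `τ < n'` ↦ the position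
`pos(v, τ) = (A_v(τ) mod q) + q·τ` of the explicit design `cikkDesign q n' ℓ` in the seed
universe `Fin (q·q)`" (`A_v(τ) = Σ_{j : v j} τ^j`, CIKK §3.1) and the restriction
`z ↦ z|_{S_v}` of a seed `z ∈ {0,1}^{q²}`, as polynomial-time STRING functions in the brick
algebra of `BrickAlgebra.lean` / `FoldBricks.lean`:

* `polyValFn` — `⟨⟨X, 1^τ⟩, …⟩`: Horner evaluation of `A_v(τ)` in binary (a fold with
  `hornerOp ⟨acc, ⟨b, c⟩⟩ = acc·b + c`), `polyValFn_apply`, `polyValFn_mem_FP`;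
* `posFn` — the unary position `1^{pos(v,τ)}` (`remFn`, `binToUnaryFn`, `umulFn`), `posFn_apply`;
* `restrictFn` — the `n'` restricted bits in order (a fold concatenating `zbits[pos(v,τ)]`),
  `restrictFn_apply`, `restrictFn_mem_FP`; and `restrictFn_eq_ofFn_cikkDesign`: on a well-formed
  record the value is `List.ofFn (z ∘ cikkDesign q n' ℓ hn v)`.

Record layout of the context: `X = ⟨pad, ⟨1^q, ⟨1^ℓ, ⟨vbits, zbits⟩⟩⟩⟩` (`pad` only pads the
length so that every intermediate value is linear in `|X|`).

## References

* M. Carmosino, R. Impagliazzo, V. Kabanets, A. Kolokolova, *Learning algorithms from natural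
  proofs*, CCC 2016, §3.1 (the design from polynomials over a prime field)
  [CarmosinoImpagliazzoKabanetsKolokolova2016].
* S. Arora, B. Barak, *Computational Complexity: A Modern Approach*, CUP 2009, §1.3
  (polynomial time is closed under composition and bounded loops) [AroraBarak2009].
-/

open Polynomial

namespace Literature.Computability.Learning

open Literature.Computability.Complexity Literature.Computability.Complexity.Brick
  Literature.Computability.Complexity.Plumb Literature.Computability.MetaComplexity _root_.Computability

/-! ### Horner evaluation of `A_v(τ) = Σ_{j : v j} τ^j` -/

/-- The Horner step `⟨acc, ⟨b, c⟩⟩ ↦ acc·⟦b⟧ + ⟦c⟧` on binary numerals. [folklore] -/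
noncomputable def hornerOp : List Bool → List Bool :=
  addFn ∘ fanoutFn (prodFn ∘ fanoutFn fstF (fstF ∘ sndF)) (sndF ∘ sndF)

/-- `hornerOp` on a record. [folklore] -/
@[simp] theorem hornerOp_apply (acc b c : List Bool) :
    hornerOp (boolPair acc (boolPair b c)) = encodeNat (bitsToNat acc * bitsToNat b + bitsToNat c) := by
  simp [hornerOp]

/-- `hornerOp ∈ FP`. [folklore] -/
theorem hornerOp_mem_FP : hornerOp ∈ FP :=
  comp_mem_FP addFn_mem_FP (fanoutFn_mem_FP
    (comp_mem_FP prodFn_mem_FP (fanoutFn_mem_FP fstF_mem_FP (comp_mem_FP fstF_mem_FP sndF_mem_FP)))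
    (comp_mem_FP sndF_mem_FP sndF_mem_FP))

/-- Additive growth of `hornerOp` on every input. [folklore] -/
theorem length_hornerOp_le (w : List Bool) :
    (hornerOp w).length ≤ (fstF w).length + (sndF w).length + 1 := by
  have h1 := length_addFn_le (fanoutFn (prodFn ∘ fanoutFn fstF (fstF ∘ sndF)) (sndF ∘ sndF) w)
  have h2 := length_prodFn_le (fanoutFn fstF (fstF ∘ sndF) w)
  have h3 := length_fstF_sndF_le (sndF w)
  rw [hornerOp, Function.comp_apply]
  simp only [fanoutFn_apply, fstF_boolPair, sndF_boolPair, Function.comp_apply] at h1 h2 ⊢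
  omega

/-- The context record of the design computations: `X = ⟨pad, ⟨1^q, ⟨1^ℓ, ⟨vbits, zbits⟩⟩⟩⟩`.
[folklore] -/
def designCtx (pad : List Bool) (q ℓ : ℕ) (vbits zbits : List Bool) : List Bool :=
  boolPair pad (boolPair (ones q) (boolPair (ones ℓ) (boolPair vbits zbits)))

/-- The Horner piece at index `j` on `⟨⟨X, 1^τ⟩, 1ʲ⟩`: the pair `⟨encodeNat τ, [v_{ℓ-1-j}]⟩`
(multiplier and next digit, most significant digit first). [folklore] -/
noncomputable def hornerPiece : List Bool → List Bool :=
  fanoutFn (lenBinF ∘ sndF ∘ fstF)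
    (bitAtFn ∘ fanoutFn (dropFn ∘ fanoutFn (List.cons true ∘ sndF) (nthF 2 ∘ fstF ∘ fstF))
      (nthF 3 ∘ fstF ∘ fstF))

/-- `hornerPiece ∈ FP`. [folklore] -/
theorem hornerPiece_mem_FP : hornerPiece ∈ FP :=
  fanoutFn_mem_FP (comp_mem_FP lenBinF_mem_FP (comp_mem_FP sndF_mem_FP fstF_mem_FP))
    (comp_mem_FP bitAtFn_mem_FP (fanoutFn_mem_FP
      (comp_mem_FP dropFn_mem_FP (fanoutFn_mem_FP (comp_mem_FP (cons_mem_FP true) sndF_mem_FP)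
        (comp_mem_FP (nthF_mem_FP 2) (comp_mem_FP fstF_mem_FP fstF_mem_FP))))
      (comp_mem_FP (nthF_mem_FP 3) (comp_mem_FP fstF_mem_FP fstF_mem_FP))))

/-- The digit read by the Horner piece at index `j`: `v_{ℓ-1-j}` (junk `[]` out of range).
[folklore] -/
def hornerDigit (ℓ : ℕ) (vbits : List Bool) (j : ℕ) : List Bool := (vbits.drop (ℓ - (j + 1))).take 1

/-- `hornerPiece` on a record. [folklore] -/
theorem hornerPiece_apply (pad : List Bool) (q ℓ : ℕ) (vbits zbits : List Bool) (τ j : ℕ) :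
    hornerPiece (boolPair (boolPair (designCtx pad q ℓ vbits zbits) (ones τ)) (ones j)) =
      boolPair (encodeNat τ) (hornerDigit ℓ vbits j) := by
  simp [hornerPiece, designCtx, hornerDigit, ones, nthF]

/-- The Horner pieces are short on the intended records: `≤ 3 (|Y| + 1)` for `Y = ⟨X, 1^τ⟩`.
[folklore] -/
theorem length_hornerPiece_apply_le (pad : List Bool) (q ℓ : ℕ) (vbits zbits : List Bool) (τ j : ℕ) :
    (hornerPiece (boolPair (boolPair (designCtx pad q ℓ vbits zbits) (ones τ)) (ones j))).length ≤
      3 * ((boolPair (designCtx pad q ℓ vbits zbits) (ones τ)).length + 1) := by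
  rw [hornerPiece_apply, length_boolPair, length_boolPair]
  have h1 : (encodeNat τ).length ≤ τ := length_encodeNat_le_self τ
  have h2 : (hornerDigit ℓ vbits j).length ≤ 1 := by
    unfold hornerDigit; exact (List.length_take_le _ _)
  have h3 : (ones τ).length = τ := by simp [ones]
  omega

/-- The model of the Horner fold: digits `d i, d (i+1), …` folded from the accumulator `a`.
[folklore] -/
def hornerModel (τ : ℕ) (d : ℕ → ℕ) : ℕ → ℕ → ℕ → ℕ
  | _, 0, a => a
  | i, k + 1, a => hornerModel τ d (i + 1) k (a * τ + d i)

/-- **The Horner fold computes `hornerModel`** on the intended records. [folklore] -/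
theorem foldAcc_hornerPiece (pad : List Bool) (q ℓ : ℕ) (vbits zbits : List Bool) (τ : ℕ) :
    ∀ (i k a : ℕ), foldAcc hornerOp hornerPiece (boolPair (designCtx pad q ℓ vbits zbits) (ones τ)) i k
      (encodeNat a) = encodeNat (hornerModel τ (fun j => bitsToNat (hornerDigit ℓ vbits j)) i k a)
  | i, 0, a => rfl
  | i, k + 1, a => by
    rw [foldAcc_succ, hornerPiece_apply, hornerOp_apply, bitsToNat_encodeNat, bitsToNat_encodeNat,
      foldAcc_hornerPiece pad q ℓ vbits zbits τ (i + 1) k]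
    rfl

/-- **The polynomial value** `A_v(τ)` on `Y = ⟨X, 1^τ⟩`: `ℓ` Horner rounds from `0`
(the fold loop of `FoldBricks.lean` with the clipped Horner piece). [cite: CarmosinoImpagliazzoKabanetsKolokolova2016, §3.1] -/
noncomputable def polyValFn : List Bool → List Bool :=
  sndPow 2 ∘ foldLoop hornerOp (clipF 3 hornerPiece) X ∘
    fanoutFn id (fanoutFn (lenBinF ∘ nthF 2 ∘ fstF) (fun _ => boolPair [] []))

/-- `polyValFn ∈ FP`. [folklore] -/
theorem polyValFn_mem_FP : polyValFn ∈ FP :=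
  comp_mem_FP (sndPow_mem_FP 2) (comp_mem_FP
    (foldLoop_clipF_mem_FP 3 hornerOp_mem_FP length_hornerOp_le hornerPiece_mem_FP X)
    (fanoutFn_mem_FP (PolyTimeComputable.id _)
      (fanoutFn_mem_FP (comp_mem_FP lenBinF_mem_FP (comp_mem_FP (nthF_mem_FP 2) fstF_mem_FP))
        (const_mem_FP _))))

/-- **Value of `polyValFn`** on `⟨X, 1^τ⟩`: the Horner value of the digits `v_{ℓ-1}, …, v_0`.
[folklore] -/
theorem polyValFn_apply (pad : List Bool) (q ℓ : ℕ) (vbits zbits : List Bool) (τ : ℕ) :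
    polyValFn (boolPair (designCtx pad q ℓ vbits zbits) (ones τ)) =
      encodeNat (hornerModel τ (fun j => bitsToNat (hornerDigit ℓ vbits j)) 0 ℓ 0) := by
  have hℓ : ℓ ≤ X.eval (boolPair (designCtx pad q ℓ vbits zbits) (ones τ)).length := by
    rw [eval_X, length_boolPair]
    have : ℓ ≤ (designCtx pad q ℓ vbits zbits).length := by
      simp only [designCtx, length_boolPair]
      have : (ones ℓ).length = ℓ := by simp [ones]
      omega
    omega
  rw [polyValFn, Function.comp_apply, Function.comp_apply, fanoutFn_apply, fanoutFn_apply, id,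
    Function.comp_apply, Function.comp_apply, fstF_boolPair]
  have hnth : nthF 2 (designCtx pad q ℓ vbits zbits) = ones ℓ := by simp [designCtx, nthF]
  rw [hnth, lenBinF_apply, show (ones ℓ).length = ℓ by simp [ones],
    show (boolPair ([] : List Bool) []) = boolPair (ones 0) (encodeNat 0) by rfl,
    foldLoop_apply _ _ hℓ, foldAcc_clipF (fun j _ _ => length_hornerPiece_apply_le pad q ℓ vbits zbits τ j),
    foldAcc_hornerPiece]
  simp [sndPow]

/-! ### The block position `pos(v, τ) = (A_v(τ) mod q) + q·τ` in unary -/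

/-- The position brick on `Y = ⟨X, 1^τ⟩`: `1^{(A mod q) + q τ}` with `A = polyValFn Y`
(`remFn`, `binToUnaryFn` against the ruler `1^q`, `umulFn`, concatenation).
[cite: CarmosinoImpagliazzoKabanetsKolokolova2016, §3.1] -/
noncomputable def posFn : List Bool → List Bool :=
  appF ∘ fanoutFn
    (binToUnaryFn ∘ fanoutFn (nthF 1 ∘ fstF) (remFn ∘ fanoutFn polyValFn (lenBinF ∘ nthF 1 ∘ fstF)))
    (HashBricks.umulFn ∘ fanoutFn (nthF 1 ∘ fstF) sndF)

/-- `posFn ∈ FP`. [folklore] -/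
theorem posFn_mem_FP : posFn ∈ FP :=
  comp_mem_FP appF_mem_FP (fanoutFn_mem_FP
    (comp_mem_FP binToUnaryFn_mem_FP (fanoutFn_mem_FP (comp_mem_FP (nthF_mem_FP 1) fstF_mem_FP)
      (comp_mem_FP remFn_mem_FP (fanoutFn_mem_FP polyValFn_mem_FP
        (comp_mem_FP lenBinF_mem_FP (comp_mem_FP (nthF_mem_FP 1) fstF_mem_FP))))))
    (comp_mem_FP HashBricks.umulFn_mem_FP (fanoutFn_mem_FP (comp_mem_FP (nthF_mem_FP 1) fstF_mem_FP)
      sndF_mem_FP)))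

/-- The number `A_v(τ)` computed by `polyValFn` (Horner value of the digits). [folklore] -/
def polyValNat (ℓ : ℕ) (vbits : List Bool) (τ : ℕ) : ℕ :=
  hornerModel τ (fun j => bitsToNat (hornerDigit ℓ vbits j)) 0 ℓ 0

/-- **Value of `posFn`** (`q ≥ 1`): `1^{(A_v(τ) mod q) + q τ}`. [folklore] -/
theorem posFn_apply (pad : List Bool) {q : ℕ} (hq : 0 < q) (ℓ : ℕ) (vbits zbits : List Bool) (τ : ℕ) :
    posFn (boolPair (designCtx pad q ℓ vbits zbits) (ones τ)) =
      ones (polyValNat ℓ vbits τ % q + q * τ) := by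
  have hnth : nthF 1 (designCtx pad q ℓ vbits zbits) = ones q := by simp [designCtx, nthF]
  rw [posFn, Function.comp_apply, fanoutFn_apply, appF_boolPair]
  simp only [Function.comp_apply, fanoutFn_apply, fstF_boolPair, sndF_boolPair, hnth, lenBinF_apply,
    polyValFn_apply, remFn_boolPair, bitsToNat_encodeNat, HashBricks.umulFn_boolPair]
  rw [show (ones q).length = q by simp [ones], binToUnaryFn_boolPair, bitsToNat_encodeNat,
    show (ones q).length = q by simp [ones], min_eq_left (Nat.mod_lt _ hq).le]
  simp only [ones, polyValNat, List.replicate_append_replicate]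

/-! ### The restriction `z|_{S_v}` as the string of bits `zbits[pos(v, τ)]`, `τ < n'` -/

/-- The piece of the restriction fold on `⟨⟨X, 1^{n'}⟩, 1^τ⟩`: the bit `zbits[pos(v, τ)]`.
[folklore] -/
noncomputable def bitPiece : List Bool → List Bool :=
  bitAtFn ∘ fanoutFn (posFn ∘ fanoutFn (fstF ∘ fstF) sndF) (sndPow 3 ∘ fstF ∘ fstF)

/-- `bitPiece ∈ FP`. [folklore] -/
theorem bitPiece_mem_FP : bitPiece ∈ FP :=
  comp_mem_FP bitAtFn_mem_FP (fanoutFn_mem_FP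
    (comp_mem_FP posFn_mem_FP (fanoutFn_mem_FP (comp_mem_FP fstF_mem_FP fstF_mem_FP) sndF_mem_FP))
    (comp_mem_FP (sndPow_mem_FP 3) (comp_mem_FP fstF_mem_FP fstF_mem_FP)))

/-- `bitPiece` on a record (`q ≥ 1`). [folklore] -/
theorem bitPiece_apply (pad : List Bool) {q : ℕ} (hq : 0 < q) (ℓ : ℕ) (vbits zbits : List Bool)
    (n' τ : ℕ) :
    bitPiece (boolPair (boolPair (designCtx pad q ℓ vbits zbits) (ones n')) (ones τ)) =
      (zbits.drop (polyValNat ℓ vbits τ % q + q * τ)).take 1 := by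
  have hz : sndPow 3 (designCtx pad q ℓ vbits zbits) = zbits := by simp [designCtx, sndPow]
  rw [bitPiece, Function.comp_apply, fanoutFn_apply]
  simp only [Function.comp_apply, fanoutFn_apply, fstF_boolPair, sndF_boolPair, hz,
    posFn_apply pad hq, bitAtFn_boolPair]
  simp [ones]

/-- **The restriction brick** on `⟨X, 1^{n'}⟩`: the `n'` bits `zbits[pos(v, τ)]`, `τ < n'`, in
order (a concatenation fold with the clipped bit piece).
[cite: CarmosinoImpagliazzoKabanetsKolokolova2016, §3.1 ("`MX_NW(i, z) = z|_{S_i}`")] -/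
noncomputable def restrictFn : List Bool → List Bool :=
  sndPow 2 ∘ foldLoop appF (clipF 1 bitPiece) X ∘
    fanoutFn id (fanoutFn (lenBinF ∘ sndF) (fun _ => boolPair [] []))

/-- `restrictFn ∈ FP`. [folklore] -/
theorem restrictFn_mem_FP : restrictFn ∈ FP :=
  comp_mem_FP (sndPow_mem_FP 2) (comp_mem_FP
    (foldLoop_clipF_mem_FP 1 appF_mem_FP length_appF_le bitPiece_mem_FP X)
    (fanoutFn_mem_FP (PolyTimeComputable.id _)
      (fanoutFn_mem_FP (comp_mem_FP lenBinF_mem_FP sndF_mem_FP) (const_mem_FP _))))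

/-- **Value of `restrictFn`** (`q ≥ 1`): the list of the bits `zbits[pos(v, τ)]` for `τ < n'`.
[folklore] -/
theorem restrictFn_apply (pad : List Bool) {q : ℕ} (hq : 0 < q) (ℓ : ℕ) (vbits zbits : List Bool)
    (n' : ℕ) :
    restrictFn (boolPair (designCtx pad q ℓ vbits zbits) (ones n')) =
      ccat (fun τ => (zbits.drop (polyValNat ℓ vbits τ % q + q * τ)).take 1) n' := by
  have hn : n' ≤ X.eval (boolPair (designCtx pad q ℓ vbits zbits) (ones n')).length := by
    rw [eval_X, length_boolPair]
    have : (ones n').length = n' := by simp [ones]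
    omega
  rw [restrictFn, Function.comp_apply, Function.comp_apply, fanoutFn_apply, fanoutFn_apply, id,
    Function.comp_apply, sndF_boolPair, lenBinF_apply, show (ones n').length = n' by simp [ones],
    show (boolPair ([] : List Bool) []) = boolPair (ones 0) ([] : List Bool) by rfl,
    foldLoop_apply _ _ hn,
    foldAcc_clipF (fun j _ _ => by
      rw [bitPiece_apply pad hq]
      exact (List.length_take_le _ _).trans (by omega)),
    foldAcc_appF]
  simp [sndPow, bitPiece_apply pad hq]

/-! ### The computed positions are those of `cikkDesign` -/

/-- The grid index of a pair: `pairIndex q (a, b) = b + q·a`. [folklore] -/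
theorem pairIndex_val (q : ℕ) [NeZero q] (a b : ZMod q) :
    ((pairIndex q (a, b) : Fin (q * q)) : ℕ) = b.val + q * a.val := by
  obtain ⟨q', rfl⟩ := Nat.exists_eq_succ_of_ne_zero (NeZero.ne q)
  simp [pairIndex, pairEquiv, finProdFinEquiv]
  rfl

/-- Closed form of the Horner model: `a τ^k + Σ_{m<k} d(i+m) τ^{k-1-m}`. [folklore] -/
theorem hornerModel_eq (τ : ℕ) (d : ℕ → ℕ) : ∀ (i k a : ℕ),
    hornerModel τ d i k a = a * τ ^ k + ∑ m ∈ Finset.range k, d (i + m) * τ ^ (k - 1 - m)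
  | i, 0, a => by simp [hornerModel]
  | i, k + 1, a => by
    rw [hornerModel, hornerModel_eq τ d (i + 1) k, Finset.sum_range_succ']
    have hs : ∑ m ∈ Finset.range k, d (i + (m + 1)) * τ ^ (k + 1 - 1 - (m + 1)) =
        ∑ m ∈ Finset.range k, d (i + 1 + m) * τ ^ (k - 1 - m) :=
      Finset.sum_congr rfl fun m _ => by
        rw [show i + (m + 1) = i + 1 + m by omega, show k + 1 - 1 - (m + 1) = k - 1 - m by omega]
    rw [hs, Nat.add_zero, show k + 1 - 1 - 0 = k by omega, pow_succ]
    ring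

/-- The Horner digits of a genuine bit string: `d j = [v (ℓ-1-j)]` for `j < ℓ`. [folklore] -/
theorem bitsToNat_hornerDigit_ofFn {ℓ : ℕ} (v : Fin ℓ → Bool) {j : ℕ} (hj : j < ℓ) :
    bitsToNat (hornerDigit ℓ (List.ofFn v) j) = (v ⟨ℓ - 1 - j, by omega⟩).toNat := by
  unfold hornerDigit
  have hlt : ℓ - (j + 1) < (List.ofFn v).length := by rw [List.length_ofFn]; omega
  rw [List.take_one_drop_eq_of_lt_length hlt]
  simp only [bitsToNat_cons, bitsToNat_nil, mul_zero, add_zero, List.get_ofFn]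
  congr 2
  apply Fin.ext
  simp only [Fin.val_cast]
  omega

/-- **`polyValNat` is `A_v(τ) = Σ_{j : v j} τ^j`.**
[cite: CarmosinoImpagliazzoKabanetsKolokolova2016, §3.1 ("`A_i(x) = Σⱼ iⱼ x^{j-1}`")] -/
theorem polyValNat_ofFn {ℓ : ℕ} (v : Fin ℓ → Bool) (τ : ℕ) :
    polyValNat ℓ (List.ofFn v) τ = ∑ j : Fin ℓ, if v j then τ ^ (j : ℕ) else 0 := by
  classical
  rw [polyValNat, hornerModel_eq, zero_mul, zero_add]
  set G : ℕ → ℕ := fun j => if h : j < ℓ then (if v ⟨j, h⟩ then τ ^ j else 0) else 0 with hG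
  have h1 : ∀ m ∈ Finset.range ℓ,
      bitsToNat (hornerDigit ℓ (List.ofFn v) m) * τ ^ (ℓ - 1 - m) = G (ℓ - 1 - m) := by
    intro m hm
    rw [Finset.mem_range] at hm
    rw [bitsToNat_hornerDigit_ofFn v hm, hG]
    simp only [show ℓ - 1 - m < ℓ by omega, dif_pos]
    cases v ⟨ℓ - 1 - m, by omega⟩ <;> simp
  simp only [zero_add]
  rw [Finset.sum_congr rfl h1, Finset.sum_range_reflect G ℓ, ← Fin.sum_univ_eq_sum_range]
  refine Finset.sum_congr rfl fun j _ => ?_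
  simp [hG, j.isLt]

/-- The position of `cikkDesign` at `(v, τ)` is `(A_v(τ) mod q) + q·τ`.
[cite: CarmosinoImpagliazzoKabanetsKolokolova2016, §3.1] -/
theorem cikkDesign_val (q n' ℓ : ℕ) [Fact q.Prime] (hn : n' ≤ q) (v : Fin ℓ → Bool) (τ : Fin n') :
    ((cikkDesign q n' ℓ hn v τ : Fin (q * q)) : ℕ) = polyValNat ℓ (List.ofFn v) τ % q + q * τ := by
  have hq : (τ : ℕ) < q := lt_of_lt_of_le τ.isLt hn
  rw [cikkDesign]
  simp only [Function.Embedding.trans_apply, polyBlock_apply, evalPoints_apply, pairIndex_val,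
    eval_ofFn_coeffVec, polyValNat_ofFn]
  congr 1
  · rw [← ZMod.val_natCast]
    congr 1
    push_cast
    refine Finset.sum_congr rfl fun j _ => ?_
    split_ifs <;> simp
  · rw [ZMod.val_natCast, Nat.mod_eq_of_lt hq]

/-- A concatenation of singletons is an `ofFn`. [folklore] -/
theorem ccat_singleton_eq_ofFn (g : ℕ → Bool) : ∀ n : ℕ,
    ccat (fun τ => [g τ]) n = List.ofFn fun τ : Fin n => g τ
  | 0 => by simp
  | n + 1 => by
    rw [ccat_succ, ccat_singleton_eq_ofFn g n, List.ofFn_succ']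
    simp

/-- **`restrictFn` computes `z|_{S_v}`** for the explicit design: on the record of a bit string `v`
and a seed `z` it returns `List.ofFn (z ∘ cikkDesign q n' ℓ hn v)`.
[cite: CarmosinoImpagliazzoKabanetsKolokolova2016, §3.1 ("`MX_NW(i, z) = z|_{S_i}`")] -/
theorem restrictFn_eq_ofFn_cikkDesign (pad : List Bool) (q n' ℓ : ℕ) [Fact q.Prime] (hn : n' ≤ q)
    (v : Fin ℓ → Bool) (z : Fin (q * q) → Bool) :
    restrictFn (boolPair (designCtx pad q ℓ (List.ofFn v) (List.ofFn z)) (ones n')) =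
      List.ofFn (z ∘ cikkDesign q n' ℓ hn v) := by
  have hq : 0 < q := (Fact.out : q.Prime).pos
  rw [restrictFn_apply pad hq]
  -- below `n'` the pieces are the singletons `[z (cikkDesign … τ)]`
  have hpos : ∀ τ : ℕ, τ < n' → polyValNat ℓ (List.ofFn v) τ % q + q * τ < q * q := by
    intro τ hτ
    have h1 := Nat.mod_lt (polyValNat ℓ (List.ofFn v) τ) hq
    have h2 : q * τ ≤ q * (q - 1) := Nat.mul_le_mul_left q (by omega)
    have h3 : q * (q - 1) + q = q * q := by
      cases q with
      | zero => omega
      | succ q' => simp [Nat.mul_succ]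
    omega
  have hpiece : ∀ τ : ℕ, τ < n' →
      ((List.ofFn z).drop (polyValNat ℓ (List.ofFn v) τ % q + q * τ)).take 1 =
        [if h : τ < n' then z (cikkDesign q n' ℓ hn v ⟨τ, h⟩) else false] := by
    intro τ hτ
    have hlt : polyValNat ℓ (List.ofFn v) τ % q + q * τ < (List.ofFn z).length := by
      rw [List.length_ofFn]; exact hpos τ hτ
    rw [List.take_one_drop_eq_of_lt_length hlt, dif_pos hτ, List.get_ofFn]
    congr 2
    exact Fin.ext (cikkDesign_val q n' ℓ hn v ⟨τ, hτ⟩).symm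
  rw [ccat_congr (fun τ hτ => hpiece τ hτ), ccat_singleton_eq_ofFn]
  simp only [Fin.is_lt, dif_pos, Fin.eta]
  rfl

end Literature.Computability.Learning
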